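import Summits.ResolutionOfSingularities.ResolutionOfSingularities.Theorems.DeltaCutSep2
import HarnessLib

/-!
# DeltaCutSepCells — decomp-res node «SepCut» (lens-6 g26, critic row 196 CLEARED +1), tree file 3/8 of the node

Content VERBATIM from the decomp-res lens-6 g26 node `HOME/decomp-res-lens-6/g26/SepCut.lean` (pin f15f025c; no
carry, imports the landed tree only); HOME = run/shared/lean/pub/decomp-res; critic row 196 CLEARED +1; landing plan
NEXT-g27.md fb3fac1c §4 + rider INBOX :1178 — provenance, critic text and the lens header in full in the first file
of the node, `DeltaCutSep`.  Namespace `…Theorems.DeltaCutClasses`; `--supports stmt-ResolutionOfSingularities-26971`.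

## This file

§SepCells — THE CELLS AND THE EXACT RE-LOCATION (node l. 464–635): `WORTopRunHeavySepTame n` / `WORTopSepHeavy n`
with `WORTopRunHeavy n`'s binders VERBATIM, the hypothesis-free carve `worTopRunHeavy_iff_sepHeavy_sepTame` /
`e1TopRunHeavy_iff_sepHeavy_sepTame`, the decided side `e1TopRunHeavySepTame_of_five (h5 : E 5)`, THE RE-LOCATION
`e1TopRunHeavy_iff_e1TopSepHeavy (h5 : E 5)` and the edges by tree names down to `e_one_iff_e1TopSepHeavy (hSC)
(h5)`; the located residual **`E1TopSepHeavy`** (THIS FILE is its cone-free HOME; the route aside `SCE1TopSepHeavy`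
points here) and its hypothesis-free split by kind `worTopSepHeavy_iff_frozen_perpetual` /
`e1TopSepHeavy_iff_frozen_perpetual` into kind F `E1TopSepFrozen` [INHABITED by C×] and kind P `E1TopSepPerpetual`
[UNDECIDED · no inhabitant known], intrinsic reading; §SepJunction (node l. 637–649; docstring-only junction with
lens-4, by name, nothing re-typed).

[WRITER NOTE (decomp-res writer g12): file split only (tree files ≤ 400 lines); namespace, sections, section opens
and every declaration exactly as in the lens (the node's HOME-only dupNamespace-linter line is dropped; the two
namespace-level `open …TwistCutClasses` / `open …LightCutClasses` lines of the node are replayed).]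

(Sources: Hironaka1967 (characteristic polyhedra); CossartJannsenSaito2020 Def. 3.13 / Thm. 3.14, Ch. 8, Thm. 9.6;
Hironaka1970 (near points / vertices); CossartPiltant2019 Prop. 2.6; CossartPiltant2008 §2; Giraud1975; Hironaka2005
(three key theorems: order under permissible blow-up); EGAIV4 §16–§17; StacksProject 0804 / 0BIQ / 031I; Matsumura1987 §28.)
-/

noncomputable section

open CategoryTheory CategoryTheory.Limits AlgebraicGeometry TopologicalSpace IsLocalRing
open Literature.AlgebraicGeometry.Resolution

universe u

namespace Summit.ResolutionOfSingularities.ResolutionOfSingularities.Theorems.DeltaCutClasses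

open Summit.ResolutionOfSingularities.ResolutionOfSingularities.Theorems.TwistCutClasses
open Summit.ResolutionOfSingularities.ResolutionOfSingularities.Theorems.LightCutClasses

section SepCells

open Summit.ResolutionOfSingularities.ResolutionOfSingularities.Theorems
open WeakOrderReduction ForcedTowerClasses SubfieldContactClasses AbsoluteContactClasses PurityValveClasses

/-! ### §SepCells — THE CELLS OF THE SEPARATING CUT: the EXACT hypothesis-free carve of `WORTopRunHeavy` / `E1TopRunHeavy`,
the decided side PROVED from five, the RE-LOCATION of the residual, the edges down to `E 1`, and the residual's two kinds -/

/-- **THE DECIDED CELL · `WORTopRunHeavySepTame n`** — weak resolution for g25's residual base data at marking `n`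
(canonical bad
run NOT terminating) whose SEPARATING RUN TERMINATES.  DECIDED (PROVED below from `SeqDimFour 5 n` by `wor_of_sepTerminates`;
inhabited by P∞, C_ax, B_S). -/
def WORTopRunHeavySepTame (n : ℕ) : Prop :=
  ∀ p : ℕ, p.Prime → ∀ (k : Type) [Field k] [CharP k p] (Y : Scheme.{0}) (g : Y ⟶ Spec (.of k)),
    IsBase Y g → ∀ M : MarkedIdeal Y, IsDatum n M → TopHeavy Y M.ideal n → TopDeltaHeavy Y M.ideal n →
      TopChainHeavy Y M.ideal n → ¬ RunTerminates n ⟨Y, M.ideal⟩ → SepTerminates n ⟨Y, M.ideal⟩ →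
        ∃ t : CentreSeq Y, WeakResolution t M

/-- **THE RESIDUAL CELL · `WORTopSepHeavy n`** — weak resolution for g25's residual base data at marking `n` whose
separating run
does NOT terminate (it FREEZES at a nonempty bad locus with irregular reduced closure — kind F, C× —, or is PERPETUAL — kind P,
no inhabitant known; exact: `not_sepTerminates_iff`).  RESIDUAL (the located successor of `WORTopRunHeavy n`). -/
def WORTopSepHeavy (n : ℕ) : Prop :=
  ∀ p : ℕ, p.Prime → ∀ (k : Type) [Field k] [CharP k p] (Y : Scheme.{0}) (g : Y ⟶ Spec (.of k)),
    IsBase Y g → ∀ M : MarkedIdeal Y, IsDatum n M → TopHeavy Y M.ideal n → TopDeltaHeavy Y M.ideal n →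
      TopChainHeavy Y M.ideal n → ¬ RunTerminates n ⟨Y, M.ideal⟩ → ¬ SepTerminates n ⟨Y, M.ideal⟩ →
        ∃ t : CentreSeq Y, WeakResolution t M

/-- **THE DECIDED family · `E1TopRunHeavySepTame`**. DECIDED. -/
def E1TopRunHeavySepTame : Prop := ∀ n : ℕ, 1 ≤ n → WORTopRunHeavySepTame n

/-- **THE RESIDUAL (family) · `E1TopSepHeavy`** — THE LOCATED RESIDUAL of the lens-6 column after g26. RESIDUAL. -/
def E1TopSepHeavy : Prop := ∀ n : ℕ, 1 ≤ n → WORTopSepHeavy n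

/-- **EXACT CARVE at one marking** (hypothesis-free): `WORTopRunHeavy n ⟺ WORTopSepHeavy n ∧ WORTopRunHeavySepTame n`
(excluded middle on `SepTerminates`). [new] [folklore] -/
theorem worTopRunHeavy_iff_sepHeavy_sepTame (n : ℕ) :
    WORTopRunHeavy n ↔ WORTopSepHeavy n ∧ WORTopRunHeavySepTame n := by
  constructor
  · intro h
    exact ⟨fun p hp k _ _ Y g hB M hM hT hD hC hr _ => h p hp k Y g hB M hM hT hD hC hr,
      fun p hp k _ _ Y g hB M hM hT hD hC hr _ => h p hp k Y g hB M hM hT hD hC hr⟩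
  · rintro ⟨hR, hD⟩ p hp k _ _ Y g hB M hM hT hDH hC hr
    by_cases hs : SepTerminates n ⟨Y, M.ideal⟩
    · exact hD p hp k Y g hB M hM hT hDH hC hr hs
    · exact hR p hp k Y g hB M hM hT hDH hC hr hs

/-- **EXACT CARVE of the family** (hypothesis-free): `E1TopRunHeavy ⟺ E1TopSepHeavy ∧ E1TopRunHeavySepTame`. [new] [folklore] -/
theorem e1TopRunHeavy_iff_sepHeavy_sepTame : E1TopRunHeavy ↔ E1TopSepHeavy ∧ E1TopRunHeavySepTame := by
  constructor
  · intro h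
    exact ⟨fun n hn => ((worTopRunHeavy_iff_sepHeavy_sepTame n).1 (h n hn)).1,
      fun n hn => ((worTopRunHeavy_iff_sepHeavy_sepTame n).1 (h n hn)).2⟩
  · rintro ⟨hR, hD⟩ n hn
    exact (worTopRunHeavy_iff_sepHeavy_sepTame n).2 ⟨hR n hn, hD n hn⟩

/-- **THE DECIDED CELL IS PROVED from `SeqDimFour 5 n`.** [new] [folklore] -/
theorem worTopRunHeavySepTame_of_five {n : ℕ} (hn : 1 ≤ n) (h5 : SeqDimFour 5 n) : WORTopRunHeavySepTame n :=
  fun p hp k _ _ Y g hB M hM _ _ _ _ hsep => wor_of_sepTerminates hn h5 p hp k Y g hB M hM hsep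

/-- **THE DECIDED family is PROVED from `E 5`** (tree: `E 5` ⟸ CJS (R), `e_five_of_RCJS`). [new] [folklore] -/
theorem e1TopRunHeavySepTame_of_five (h5 : E 5) : E1TopRunHeavySepTame :=
  fun n hn => worTopRunHeavySepTame_of_five hn (h5 n hn)

/-- **RE-LOCATION OF THE RESIDUAL (rule (C))**: under `E 5`, `E1TopRunHeavy ⟺ E1TopSepHeavy` — g25's located residual is
EQUIVALENT to its typed sub-class «the separating run does not terminate either», STRICTLY smaller as a class of data
(P∞, C_ax, B_S are g25-residual and g26-decided: §SepCertificates). [new] [folklore] -/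
theorem e1TopRunHeavy_iff_e1TopSepHeavy (h5 : E 5) : E1TopRunHeavy ↔ E1TopSepHeavy :=
  ⟨fun h => (e1TopRunHeavy_iff_sepHeavy_sepTame.1 h).1,
    fun h => e1TopRunHeavy_iff_sepHeavy_sepTame.2 ⟨h, e1TopRunHeavySepTame_of_five h5⟩⟩

/-- Per marking: under `SeqDimFour 5 n`, `WORTopRunHeavy n ⟺ WORTopSepHeavy n`. [new] [folklore] -/
theorem worTopRunHeavy_iff_worTopSepHeavy {n : ℕ} (hn : 1 ≤ n) (h5 : SeqDimFour 5 n) :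
    WORTopRunHeavy n ↔ WORTopSepHeavy n :=
  ⟨fun h => ((worTopRunHeavy_iff_sepHeavy_sepTame n).1 h).1,
    fun h => (worTopRunHeavy_iff_sepHeavy_sepTame n).2 ⟨h, worTopRunHeavySepTame_of_five hn h5⟩⟩

/-- g24's residual: under `E 5`, `E1TopChainHeavy ⟺ E1TopSepHeavy` (g25 `e1TopChainHeavy_iff_e1TopRunHeavy` ∘ g26).
[new] [folklore] -/
theorem e1TopChainHeavy_iff_e1TopSepHeavy (h5 : E 5) : E1TopChainHeavy ↔ E1TopSepHeavy :=
  (e1TopChainHeavy_iff_e1TopRunHeavy h5).trans (e1TopRunHeavy_iff_e1TopSepHeavy h5)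

/-- Per marking: under `SeqDimFour 5 n`, `WORTopChainHeavy n ⟺ WORTopSepHeavy n`. [new] [folklore] -/
theorem worTopChainHeavy_iff_worTopSepHeavy {n : ℕ} (hn : 1 ≤ n) (h5 : SeqDimFour 5 n) :
    WORTopChainHeavy n ↔ WORTopSepHeavy n :=
  (worTopChainHeavy_iff_worTopRunHeavy hn h5).trans (worTopRunHeavy_iff_worTopSepHeavy hn h5)

/-- g23's residual: under `E 5`, `E1TopDeltaHeavy ⟺ E1TopSepHeavy`. [new] [folklore] -/
theorem e1TopDeltaHeavy_iff_e1TopSepHeavy (h5 : E 5) : E1TopDeltaHeavy ↔ E1TopSepHeavy :=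
  (e1TopDeltaHeavy_iff_e1TopRunHeavy h5).trans (e1TopRunHeavy_iff_e1TopSepHeavy h5)

/-- **THE WHOLE COLUMN after g26**: under `E 5`, `E1TopHeavy ⟺ E1TopSepHeavy` (tree `e1TopHeavy_iff_e1TopDeltaHeavy` ∘ g24 ∘ g25
∘ g26). [new] [folklore] -/
theorem e1TopHeavy_iff_e1TopSepHeavy (h5 : E 5) : E1TopHeavy ↔ E1TopSepHeavy :=
  (e1TopHeavy_iff_e1TopRunHeavy h5).trans (e1TopRunHeavy_iff_e1TopSepHeavy h5)

/-- **DOWN-LINK TO ITEM 26971's CLASS**: under `SubfieldContactAbs` and `E 5`, `E1TopNoAbs ⟺ E1TopSepHeavy`. [new] [folklore] -/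
theorem e1TopNoAbs_iff_e1TopSepHeavy (hSC : SubfieldContactAbs) (h5 : E 5) : E1TopNoAbs ↔ E1TopSepHeavy :=
  (e1TopNoAbs_iff_e1TopRunHeavy hSC h5).trans (e1TopRunHeavy_iff_e1TopSepHeavy h5)

/-- **SUMMIT EDGE after g26** (tree `LightCutClasses.e_one_iff_e1TopHeavy` ∘ …): under `SubfieldContactAbs` and `E 5`,
`E 1 ⟺ E1TopSepHeavy` — the column's ONE open statement is the separating residual. [new] [folklore] -/
theorem e_one_iff_e1TopSepHeavy (hSC : SubfieldContactAbs) (h5 : E 5) : E 1 ↔ E1TopSepHeavy :=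
  (e_one_iff_e1TopRunHeavy hSC h5).trans (e1TopRunHeavy_iff_e1TopSepHeavy h5)

/-- **RESIDUAL SUB-CELL of KIND F · `WORTopSepFrozen n`** — the separating run FREEZES (nonempty bad locus with
IRREGULAR reduced
closure at the first inactive level; C×).  RESIDUAL (kind F). -/
def WORTopSepFrozen (n : ℕ) : Prop :=
  ∀ p : ℕ, p.Prime → ∀ (k : Type) [Field k] [CharP k p] (Y : Scheme.{0}) (g : Y ⟶ Spec (.of k)),
    IsBase Y g → ∀ M : MarkedIdeal Y, IsDatum n M → TopHeavy Y M.ideal n → TopDeltaHeavy Y M.ideal n →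
      TopChainHeavy Y M.ideal n → ¬ RunTerminates n ⟨Y, M.ideal⟩ → SepFrozen n ⟨Y, M.ideal⟩ →
        ∃ t : CentreSeq Y, WeakResolution t M

/-- **RESIDUAL SUB-CELL of KIND P · `WORTopSepPerpetual n`** — the separating run is PERPETUAL (every level active forever; no
inhabitant known, none claimed).  RESIDUAL (kind P). -/
def WORTopSepPerpetual (n : ℕ) : Prop :=
  ∀ p : ℕ, p.Prime → ∀ (k : Type) [Field k] [CharP k p] (Y : Scheme.{0}) (g : Y ⟶ Spec (.of k)),
    IsBase Y g → ∀ M : MarkedIdeal Y, IsDatum n M → TopHeavy Y M.ideal n → TopDeltaHeavy Y M.ideal n →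
      TopChainHeavy Y M.ideal n → ¬ RunTerminates n ⟨Y, M.ideal⟩ → SepPerpetual n ⟨Y, M.ideal⟩ →
        ∃ t : CentreSeq Y, WeakResolution t M

/-- RESIDUAL kind-F family. RESIDUAL. -/
def E1TopSepFrozen : Prop := ∀ n : ℕ, 1 ≤ n → WORTopSepFrozen n

/-- RESIDUAL kind-P family. RESIDUAL. -/
def E1TopSepPerpetual : Prop := ∀ n : ℕ, 1 ≤ n → WORTopSepPerpetual n

/-- **EXACT CARVE OF THE RESIDUAL INTO ITS TWO KINDS** (hypothesis-free; trichotomy + exclusivity):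
`WORTopSepHeavy n ⟺ WORTopSepFrozen n ∧ WORTopSepPerpetual n`. [new] [folklore] -/
theorem worTopSepHeavy_iff_frozen_perpetual (n : ℕ) :
    WORTopSepHeavy n ↔ WORTopSepFrozen n ∧ WORTopSepPerpetual n := by
  constructor
  · intro h
    exact ⟨fun p hp k _ _ Y g hB M hM hT hD hC hr hF =>
        h p hp k Y g hB M hM hT hD hC hr ((not_sepTerminates_iff n ⟨Y, M.ideal⟩).2 (Or.inl hF)),
      fun p hp k _ _ Y g hB M hM hT hD hC hr hP =>
        h p hp k Y g hB M hM hT hD hC hr ((not_sepTerminates_iff n ⟨Y, M.ideal⟩).2 (Or.inr hP))⟩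
  · rintro ⟨hF, hP⟩ p hp k _ _ Y g hB M hM hT hD hC hr hs
    rcases (not_sepTerminates_iff n ⟨Y, M.ideal⟩).1 hs with h | h
    · exact hF p hp k Y g hB M hM hT hD hC hr h
    · exact hP p hp k Y g hB M hM hT hD hC hr h

/-- the same for the families: `E1TopSepHeavy ⟺ E1TopSepFrozen ∧ E1TopSepPerpetual`. [new] [folklore] -/
theorem e1TopSepHeavy_iff_frozen_perpetual : E1TopSepHeavy ↔ E1TopSepFrozen ∧ E1TopSepPerpetual := by
  constructor
  · intro h
    exact ⟨fun n hn => ((worTopSepHeavy_iff_frozen_perpetual n).1 (h n hn)).1,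
      fun n hn => ((worTopSepHeavy_iff_frozen_perpetual n).1 (h n hn)).2⟩
  · rintro ⟨hF, hP⟩ n hn
    exact (worTopSepHeavy_iff_frozen_perpetual n).2 ⟨hF n hn, hP n hn⟩

/-- **THE RESIDUAL READ INTRINSICALLY**: `WORTopSepHeavy n` is weak resolution for ALL base `n`-data whose canonical bad run AND
separating run both fail to terminate — the three g23–g25 heaviness binders are implied (g25 `worTopRunHeavy_iff_intrinsic`).
[new] [folklore] -/
theorem worTopSepHeavy_iff_intrinsic {n : ℕ} (hn : 1 ≤ n) :
    WORTopSepHeavy n ↔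
      ∀ p : ℕ, p.Prime → ∀ (k : Type) [Field k] [CharP k p] (Y : Scheme.{0}) (g : Y ⟶ Spec (.of k)),
        IsBase Y g → ∀ M : MarkedIdeal Y, IsDatum n M → ¬ RunTerminates n ⟨Y, M.ideal⟩ → ¬ SepTerminates n ⟨Y, M.ideal⟩ →
          ∃ t : CentreSeq Y, WeakResolution t M := by
  constructor
  · intro h p hp k _ _ Y g hB M hM hr hs
    haveI : IsLocallyNoetherian Y := isLocallyNoetherian_of_isBase hB
    have hC : TopChainHeavy Y M.ideal n := topChainHeavy_of_not_runTerminates hr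
    have hD : TopDeltaHeavy Y M.ideal n := topDeltaHeavy_of_topChainHeavy hp hB hn hM hC
    exact h p hp k Y g hB M hM (topHeavy_of_topDeltaHeavy hD) hD hC hr hs
  · intro h p hp k _ _ Y g hB M hM _ _ _ hr hs
    exact h p hp k Y g hB M hM hr hs

/-- **STRICTNESS OVER g25 AT THE LEVEL OF LETTERS (hyp-free)**: a stage whose canonical bad run is perpetual with g25's hop
REPRODUCING the stage up to the step-2 blow-up is not excluded by any g25 letter — but every FINITE NONEMPTY level is ACTIVE for
the separating run (`sepActive_of_badFinite`), so on g25's kind B the separating run always MOVES at level `0`; what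
it does next
is decided by the certificates (P∞: terminates at sep-height 1). [new] [folklore] -/
theorem sepActive_of_runPerpetual {n : ℕ} {N : Stage} [IsLocallyNoetherian N.Y] (h : RunPerpetual n N) : SepActive n N :=
  sepActive_of_badFinite (h 0).1 (Set.nonempty_iff_ne_empty.mp (h 0).2)

/-! ### §SepJunction — lens-4 (towers) BY NAME ONLY (0-weight; first poster respected; nothing re-typed)

* P∞'s support `V(z, u, s·w)` (two crossing lines) has NO isolated point, at level 0 and — by self-reproduction — at every level
  of its canonical bad run: P∞ is a datum of `ForcedTowerClasses.NonIsolatedReduction 3`'s class (hypothesis `∀ y ∈ supp, ¬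
  IsIsolatedIn supp y`), it carries NO `ForcedTower` (the field `ForcedTower.isolated` fails at every level), and the tree's
  `wor_iff_pieces` (`WOR n ↔ ForcedTowersTerminate n ∧ NonIsolatedReduction n` mod the three tower ports) places its weak
  resolution in the `NonIsolatedReduction` conjunct (`nonIsolatedReduction_of_wor`) — which this node DECIDES for P∞ by the
  separating law (sep-height 1), citing no tower theorem and no port.
* Conversely nothing here imports a tower theorem into kind B/F/P (junction rule of row 190): the separating run is a different
  object (centres = reduced closures of whole bad levels and strict transforms of old top loci, never marked points).
* g25 junctions (a) `tower_stage_not_chainLightAt`, (b) `… → NoTowerWild n P` mod `TowerObstructs` stand unchanged (cite). -/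

end SepCells

section SepJunction
/-! ### §SepJunction — lens-4 (towers) BY NAME ONLY (0-weight; first poster respected; nothing re-typed)

* P∞'s support `V(z, u, s·w)` (two crossing lines) has NO isolated point, at level 0 and — by self-reproduction — at every level
  of its canonical bad run: P∞ is a datum of `ForcedTowerClasses.NonIsolatedReduction 3`'s class (hypothesis `∀ y ∈ supp, ¬
  IsIsolatedIn supp y`), it carries NO `ForcedTower` (the field `ForcedTower.isolated` fails at every level), and the tree's
  `wor_iff_pieces` (`WOR n ↔ ForcedTowersTerminate n ∧ NonIsolatedReduction n` mod the three tower ports) places its weak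
  resolution in the `NonIsolatedReduction` conjunct (`nonIsolatedReduction_of_wor`) — which this node DECIDES for P∞ by the
  separating law (sep-height 1), citing no tower theorem and no port.
* Conversely nothing here imports a tower theorem into kind B/F/P (junction rule of row 190): the separating run is a different
  object (centres = reduced closures of whole bad levels and strict transforms of old top loci, never marked points).
* g25 junctions (a) `tower_stage_not_chainLightAt`, (b) `… → NoTowerWild n P` mod `TowerObstructs` stand unchanged (cite). -/
end SepJunction

end Summit.ResolutionOfSingularities.ResolutionOfSingularities.Theorems.DeltaCutClasses
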